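import Literature.IUT.HodgeArakelov.FlSymmetryGenuineTower
import Literature.IUT.HodgeArakelov.TwoSectionsNonVacuity
import HarnessLib

/-!
# [IUTchII] Rmk. 1.1.1 (iii)–(iv): `FlSymmetry` WITNESSED at the GENUINE [EtTh] frame — tower, theta quotient AND the two
# sections all genuine (assembly of p442142 with abc-iut-w5-d225's `TwoSectionsNonVacuity`)

Mochizuki, *Inter-universal Teichmüller theory II*, §1, Remark 1.1.1 (iii)–(iv), kurims manuscript (Dec. 2020)
pp. 22–24 [claim: Mochizuki2012, status: disputed] (IUTchII §1 Rmk 1.1.1 (iv), kurims pp.23-24): «… a natural bilinear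
commutator map … the mono-theta-theoretic cyclotomic rigidity isomorphism … admits a certain symmetry with respect to
the group `Δ_C(M^Θ)/Δ_X̲(M^Θ) ≅ 𝔽_l^{⋊±}`». [cite: MochizukiEtTh2009, Prop 2.12 (i) p.45]

abc-iut cell, layer L6, NV-L6 row **FlSymmetry** (GENUINE frame), seat abc-iut-w4-d019 (gen 3), by-name row
«FLSYM-GENUINE», part 3 (assembly). PROOF-ONLY (0 `def` / `instance` / `structure`).

`ModelFrame.exists_coreTower_flSymmetry_of_cLevelData` (part 2, p442142) gives, at the genuine `𝔽_l^{⋊±}`-compatible core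
tower `W` of abc-iut-w5-d225's p437733 (pins `W.PiC = Π^tp_C`, `W.kerEll = Ker(Π^tp_X ↠ (Π^tp_X)^ell) ∩ Π^tp_{Y̲̲}`,
`W.Xbar = Π^tp_X`, `W.X = inclX(toZ⁻¹(l·ℤ))`), `Nonempty (FlSymmetry Sec)` for every model theta-quotient datum `T` and
EVERY `Sec : TwoSections T W`; abc-iut-w5-d225's `ModelFrame.exists_twoSections_of_coreTower` (p437698) produces, for
every core tower with that `kerEll`, the model `T` (theta section `e⁻¹(s^alg(thetaKer))`) together with a GENUINE
`TwoSections T W` (theta section, algebraic section, bilinear commutator map; Heisenberg surjectivity [EtTh] Prop. 2.12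
(i)). Composing the two: `ModelFrame.exists_flSymmetry_genuine` — under the binders `cl : CLevelData`, `hO : IsEtThOrigin`,
`hYcl`, `hR1c` (the (R1c) clause «the inversion acts by `−1` on `Z`») and `hlS : S.l = l`, THERE EXIST a core tower `W`
(the four pins recorded), a theta-quotient datum `T` (model theta section recorded) and a two-sections datum
`Sec : TwoSections T W` with `Nonempty (FlSymmetry Sec)` — every parameter record of the Rmk. 1.1.1 (iv) symmetry is now
inhabited at the genuine frame SIMULTANEOUSLY (action data DEGENERATE = trivial actions, as labelled in abc-iut-w5-d219's
`FlSymmetry.nonempty_of`; the typed record does not pin `act` to conjugation). NOT asserted: `rigidity_is_difference`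
(hence not `Rmk111_structures`) — see abc-iut-w5-d225's sign-convention record `TwoSectionsRigidityConvention.lean`.
No `Prop` fact, no FACT-LIST row; no side taken on [IUTchIII] Cor. 3.12 (Rmk. 1.1.1 is outside the cone); typed ≠
proved; witnessed ≠ discharged.
-/

noncomputable section

namespace Literature.IUT.HodgeArakelov

open Literature.AnabelianGeometry.EtaleTheta Literature.AnabelianGeometry.SemiGraphs
open scoped Literature.AnabelianGeometry.EtaleTheta

namespace ModelFrame

variable {p : ℕ} [Fact p.Prime] {Mt : MuTwoSetting p}
  {E : Mt.toThetaSetting.EtaleThetaData} {l : ℕ} (C : E.DoubleUnderline l)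
  {S : ThetaSetting.{0}} (μ : Mt.toThetaSetting.CyclotomeMod l S.N)
  (hC : Mt.toThetaSetting.Compat) (hS : Mt.toThetaSetting.Sec2Hyps)
  (h15 : ThetaSetting.Prop15iii E hC) (L : C.CuspLabels)
  (F : ModelFrame S (C.rigidData μ hC hS h15 L)) {Menv : MonoThetaEnv S}
  (e : Menv.Pi ≃ₜ* (C.rigidData μ hC hS h15 L).env)

/-- **IUTchII:Rmk1.1.1(iv) — `FlSymmetry` WITNESSED-GENUINE, every parameter record genuine at once.** Under
`cl : CLevelData`, `hO : IsEtThOrigin`, `hYcl`, the (R1c) clause `hR1c` and `hlS : S.l = l`: there are a core tower `W`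
over the Def. 1.1 (i) output of the [EtTh] model frame (p437733's four pins), the model theta-quotient datum `T`
(abc-iut-w4-d030; theta section `e⁻¹(s^alg(thetaKer))`) and a GENUINE two-sections datum `Sec : TwoSections T W`
(abc-iut-w5-d225, p437698) such that the Rmk. 1.1.1 (iv) record `FlSymmetry Sec` is inhabited (p442142).
[claim: Mochizuki2012, status: disputed] (IUTchII §1 Rmk 1.1.1 (iv), kurims pp.23-24) -/
theorem exists_flSymmetry_genuine (cl : Mt.CLevelData) (hO : Mt.toThetaSetting.IsEtThOrigin)
    (hYcl : (Mt.DtpY.map Mt.toHat.toMonoidHom).topologicalClosure ≤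
      Mt.DtpY.map Mt.toHat.toMonoidHom ⊔ (⁅⁅Mt.DeltaHat, Mt.DeltaHat⁆, Mt.DeltaHat⁆).topologicalClosure)
    (hR1c : ∀ x : Mt.PiTemp, Mt.toZ (cl.conjX Mt.epsPM x) = (Mt.toZ x)⁻¹) (hlS : S.l = l) :
    ∃ (W : CoreTower (F.reconstruction e)) (T : ThetaQuotientData (F.reconstruction e)) (Sec : TwoSections T W),
      W.PiC = TopGroup.of Mt.GtpC ∧
      W.kerEll = ((Mt.thetaToEll.comp Mt.toTheta).ker).comap
        (C.Huu.subtype.comp (Mt.GtpY.subgroupOf C.Huu).subtype) ∧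
      HEq W.Xbar Mt.inclX.range ∧
      HEq W.X (((Subgroup.zpowers (Multiplicative.ofAdd (l : ℤ))).comap Mt.toZ).map Mt.inclX) ∧
      T.thetaSection = (((C.rigidData μ hC hS h15 L).thetaKer.subgroupOf (C.rigidData μ hC hS h15 L).PiY).map
        (CycEnvelope.algSection (C.rigidData μ hC hS h15 L).augY (C.rigidData μ hC hS h15 L).chi)).comap
          e.toMulEquiv.toMonoidHom ∧
      Nonempty (FlSymmetry Sec) := by
  obtain ⟨W, h1, h2, h3, h4, hFl⟩ :=
    exists_coreTower_flSymmetry_of_cLevelData C μ hC hS h15 L F e cl hO hYcl hR1c hlS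
  obtain ⟨T, hT, ⟨Sec⟩⟩ := exists_twoSections_of_coreTower C μ hC hS h15 L F e hO hYcl W h2
  exact ⟨W, T, Sec, h1, h2, h3, h4, hT, hFl T hT Sec⟩

end ModelFrame

end Literature.IUT.HodgeArakelov

end
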